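import Literature.NumberTheory.EllipticCurves.HeightConductorBoundsModularity
import Literature.NumberTheory.LFunctions.RobinSquarefreeOdd
import Mathlib.NumberTheory.ArithmeticFunction.Misc
import Mathlib.Data.Nat.Squarefree
import Mathlib.Data.Nat.Factorization.Induction
import HarnessLib

/-!
# von Känel–Matschke, proof of Prop. 10.8 (ii): the explicit inputs (eq:tau) and (eq:lbound) —
# PROVED over the tree

Topic `Literature/NumberTheory/EllipticCurves` (family `abc`, LADDER-ABC A1: the *modular method*).
A proofs-only companion (theorems only; NO definition, NO new named fact, nothing restated; D-0026)
of `HeightConductorBoundsModularity.lean`, following R. von Känel, B. Matschke, arXiv:1605.06079 =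
Mem. AMS **286** (2023) no. 1419 [`VonkanelMatschke2023`], **§10.5.3, proof of Prop. 10.8 (ii)**,
for the quantities `l = vkmIndexL N = ⌊(N/6) ∏_{p∣N}(p+1)⌋` and
`max_J Σ_{j∈J} log(τ(j) j^{1/2})` (`maxLogTauSum`) of (10.x) `def:bb*`:

* **(eq:tau) `τ(n) ≤ 8.5 n^{1/4}` for all `n ≥ 1`**, in the integral form `τ(n)⁴ ≤ 5092 n`
  (`card_divisors_pow_four_le`). Printed proof: *"`u(n) = τ(n)/n^{1/4}` … is multiplicative and
  satisfies `u(n) = ∏_p (n_p+1) p^{−n_p/4}` … `(n_p+1)p^{−n_p/4} < 1` provided that `p ≥ 17` or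
  `n_p ≥ 17`. Thus after checking the remaining cases we find that `sup(u) = 8.44…`; in fact this
  supremum is attained at `n = 2⁵·3³·5²·7·11·13`."* Here: the local maxima `(n_p+1)⁴/p^{n_p}` are
  `81/2, 256/27, 81/25, 16/7, 16/11, 16/13` at `p = 2, 3, 5, 7, 11, 13` (attained at
  `n_p = 5, 3, 2, 1, 1, 1`) and `≤ 1` for `p ≥ 17`, with product `5091.04… ≤ 5092 < 8.5⁴`.
* Hence every summand of `β` satisfies `log(τ(j)√j) ≤ ¼ log 5092 + ¾ log l` (`1 ≤ j ≤ l`) and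
  `max_J Σ_{j∈J} log(τ(j)√j) ≤ m (¼ log 5092 + ¾ log l)` over `|J| ≤ m` (`maxLogTauSum_le`) — the
  printed *"(eq:tau) gives `β ≤ β' = m(½ log m + ¾ log l + log 8.5)`"*.
* **(eq:lbound)-substitute.** The print bounds `l` through (eq:keyexplbound)
  `∏_{p∣n}(1+1/p) ≤ (6e^γ/π²)(log log n + 2/log log n)` (Rosser–Schoenfeld's effective Mertens and
  prime number theorems plus machine checks). The tree instead PROVES Robin's inequality for every
  squarefree `n ∉ {1, 2, 3, 5, 6, 10, 30}` (Choie–Lichiardopol–Moree–Solé 2007, Thm. 1.1,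
  `Literature.NumberTheory.LFunctions.robinInequality_of_squarefree`), i.e.
  `∏_{p∣N}(p+1) = σ(rad N) < e^γ rad(N) log log rad(N)`; this gives
  `l ≤ (e^γ/6) N² log log N` whenever `rad N ∉ {2, 3, 5, 6, 10, 30}` (`vkmIndexL_le_of_rad_not_mem`)
  and `l ≤ (2/5) N²` in the six remaining radical classes (`vkmIndexL_le_of_rad_mem`; there
  `∏_{p∣N}(1+1/p) ≤ (3/2)(4/3)(6/5) = 12/5`). These are weaker than (eq:lbound) by the factor `π²/6`
  inside the logarithm, which the final constants of Prop. 10.8 (ii) absorb (assembled in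
  `HeightConductorBoundsPropTenEightProofs.lean`).

No `abc` claim; typed ≠ endorsed. All theorems; axioms standard.

## References

* R. von Känel, B. Matschke, arXiv:1605.06079 (2016) = Mem. AMS 286 (2023), §10.5.3: (eq:tau),
  (eq:keyexplbound), (eq:lbound), Remark 10.10. [VonkanelMatschke2023]
* Y. Choie, N. Lichiardopol, P. Moree, P. Solé, *On Robin's criterion for the Riemann hypothesis*,
  J. Théor. Nombres Bordeaux 19 (2007) 357–372, Thm. 1.1. [CLMS2007]
-/

noncomputable section

open Finset Real

namespace Literature.NumberTheory.EllipticCurves.ModularForms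

/-! ### 1. (eq:tau): `τ(n)⁴ ≤ 5092 n`, i.e. `τ(n) ≤ 8.447 n^{1/4} ≤ 8.5 n^{1/4}` -/

/-- Growth of `(a+1)⁴`: `(a+2)⁴ ≤ 2 (a+1)⁴` for `a ≥ 6` (`(8/7)⁴ < 2`). [folklore] -/
private theorem pow_four_succ_le_two_mul {a : ℕ} (ha : 6 ≤ a) :
    (((a + 2 : ℕ) : ℝ)) ^ 4 ≤ 2 * (((a + 1 : ℕ) : ℝ)) ^ 4 := by
  have ha' : (6 : ℝ) ≤ a := by exact_mod_cast ha
  push_cast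
  nlinarith [sq_nonneg ((a : ℝ) + 1), sq_nonneg ((a : ℝ) + 2), sq_nonneg ((a : ℝ) - 6),
    mul_nonneg (mul_nonneg (sub_nonneg.mpr ha') (sq_nonneg ((a : ℝ) + 1))) (sq_nonneg ((a : ℝ) + 1))]

/-- From the base cases `a ≤ 6` to all `a`: if `(a+1)⁴ ≤ C p^a` for `a ≤ 6` (`p ≥ 2`, `C ≥ 0`) then
for all `a`. [folklore] -/
private theorem pow_four_le_of_base {p : ℕ} (hp : 2 ≤ p) {C : ℝ} (hC : 0 ≤ C)
    (hbase : ∀ a : ℕ, a ≤ 6 → (((a + 1 : ℕ) : ℝ)) ^ 4 ≤ C * (p : ℝ) ^ a) (a : ℕ) :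
    (((a + 1 : ℕ) : ℝ)) ^ 4 ≤ C * (p : ℝ) ^ a := by
  rcases Nat.lt_or_ge a 7 with ha | ha
  · exact hbase a (by omega)
  · induction a, ha using Nat.le_induction with
    | base => calc (((7 + 1 : ℕ) : ℝ)) ^ 4 = (((6 + 2 : ℕ) : ℝ)) ^ 4 := by norm_num
        _ ≤ 2 * (((6 + 1 : ℕ) : ℝ)) ^ 4 := pow_four_succ_le_two_mul le_rfl
        _ ≤ 2 * (C * (p : ℝ) ^ 6) := by gcongr; exact hbase 6 le_rfl
        _ ≤ C * (p : ℝ) ^ 7 := by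
          have hp' : (2 : ℝ) ≤ p := by exact_mod_cast hp
          have : (0 : ℝ) ≤ C * (p : ℝ) ^ 6 := by positivity
          nlinarith
    | succ b hb ih =>
      calc (((b + 1 + 1 : ℕ) : ℝ)) ^ 4 = (((b + 2 : ℕ) : ℝ)) ^ 4 := by push_cast; ring
        _ ≤ 2 * (((b + 1 : ℕ) : ℝ)) ^ 4 := pow_four_succ_le_two_mul (by omega)
        _ ≤ 2 * (C * (p : ℝ) ^ b) := by gcongr
        _ ≤ C * (p : ℝ) ^ (b + 1) := by
          have hp' : (2 : ℝ) ≤ p := by exact_mod_cast hp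
          have : (0 : ℝ) ≤ C * (p : ℝ) ^ b := by positivity
          rw [pow_succ]
          nlinarith

/-- **vKM (eq:tau), integral form: `τ(n)⁴ ≤ 5092 n` for every `n`** (so `τ(n) ≤ 8.447… n^{1/4}
`≤ 8.5 n^{1/4}`; the printed supremum `8.44…` of `τ(n)/n^{1/4}` is attained at
`n = 2⁵·3³·5²·7·11·13`, where `τ(n)⁴/n = (81/2)(256/27)(81/25)(16/7)(16/11)(16/13) = 5091.04…`).
Proof as printed: `τ(n)⁴/n = ∏_p (n_p+1)⁴ p^{−n_p}` with each factor bounded by its maximum over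
`n_p` (`= 1` for `p ≥ 17`). [cite: VonkanelMatschke2023, §10.5.3 (eq:tau)] -/
theorem card_divisors_pow_four_le (n : ℕ) : ((n.divisors.card : ℕ) : ℝ) ^ 4 ≤ 5092 * n := by
  -- the local maxima of `(a+1)⁴/p^a`
  let c : ℕ → ℝ := fun p ↦ if p = 2 then 81 / 2 else if p = 3 then 256 / 27 else
    if p = 5 then 81 / 25 else if p = 7 then 16 / 7 else if p = 11 then 16 / 11 else
    if p = 13 then 16 / 13 else 1
  have hc1 : ∀ p, 1 ≤ c p := by
    intro p; simp only [c]; split_ifs <;> norm_num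
  have hc0 : ∀ p, 0 ≤ c p := fun p ↦ zero_le_one.trans (hc1 p)
  -- prime powers: `(a+1)⁴ ≤ c(p) p^a`
  have hpp : ∀ p a : ℕ, p.Prime → (((a + 1 : ℕ) : ℝ)) ^ 4 ≤ c p * (p : ℝ) ^ a := by
    intro p a hp
    refine pow_four_le_of_base hp.two_le (hc0 p) (fun a ha ↦ ?_) a
    by_cases h17 : 17 ≤ p
    · have hc' : c p = 1 := by simp only [c]; split_ifs <;> first | omega | rfl
      rw [hc', one_mul]
      have hp17 : (17 : ℝ) ≤ p := by exact_mod_cast h17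
      calc (((a + 1 : ℕ) : ℝ)) ^ 4 ≤ (17 : ℝ) ^ a := by
            interval_cases a <;> norm_num
        _ ≤ (p : ℝ) ^ a := pow_le_pow_left₀ (by norm_num) hp17 a
    · have hp16 : p ≤ 16 := by omega
      have hp2 := hp.two_le
      have hcases : p = 2 ∨ p = 3 ∨ p = 5 ∨ p = 7 ∨ p = 11 ∨ p = 13 := by
        interval_cases p <;> first | omega | exact absurd hp (by decide)
      rcases hcases with rfl | rfl | rfl | rfl | rfl | rfl <;> simp only [c] <;>
        interval_cases a <;> norm_num
  -- multiplicativity: `τ(n)⁴ ≤ (∏_{p ∣ n} c(p)) · n`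
  have key : ∀ n : ℕ, n ≠ 0 →
      ((n.divisors.card : ℕ) : ℝ) ^ 4 ≤ (∏ p ∈ n.primeFactors, c p) * n := by
    intro n
    induction n using Nat.recOnPosPrimePosCoprime with
    | prime_pow p k hp hk =>
      intro _
      rw [Nat.primeFactors_prime_pow hk.ne' hp, prod_singleton, ← ArithmeticFunction.sigma_zero_apply,
        ArithmeticFunction.sigma_zero_apply_prime_pow hp]
      have h := hpp p k hp
      push_cast at h ⊢
      exact h
    | zero => intro h; exact absurd rfl h
    | one => intro _; simp
    | coprime a b ha hb hab iha ihb =>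
      intro _
      rw [Nat.Coprime.card_divisors_mul hab, hab.primeFactors_mul, prod_union hab.disjoint_primeFactors]
      push_cast
      rw [mul_pow]
      have ha' := iha (by omega)
      have hb' := ihb (by omega)
      have h0a : (0 : ℝ) ≤ ((a.divisors.card : ℕ) : ℝ) ^ 4 := by positivity
      have h0b : (0 : ℝ) ≤ ((b.divisors.card : ℕ) : ℝ) ^ 4 := by positivity
      calc ((a.divisors.card : ℕ) : ℝ) ^ 4 * ((b.divisors.card : ℕ) : ℝ) ^ 4
          ≤ ((∏ p ∈ a.primeFactors, c p) * a) * ((∏ p ∈ b.primeFactors, c p) * b) :=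
            mul_le_mul ha' hb' h0b ((h0a.trans ha'))
        _ = _ := by ring
  -- the product of the six local maxima
  have hprod : ∀ n : ℕ, ∏ p ∈ n.primeFactors, c p ≤ 5092 := by
    intro n
    set T : Finset ℕ := {2, 3, 5, 7, 11, 13} with hT
    have hsplit := Finset.prod_sdiff (s₁ := n.primeFactors ∩ T) (s₂ := n.primeFactors) (f := c)
      Finset.inter_subset_left
    have hone : ∏ p ∈ n.primeFactors \ (n.primeFactors ∩ T), c p = 1 := by
      refine Finset.prod_eq_one fun p hp ↦ ?_
      have hpT : p ∉ T := fun h ↦ (Finset.mem_sdiff.mp hp).2 (Finset.mem_inter.mpr ⟨(Finset.mem_sdiff.mp hp).1, h⟩)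
      simp only [hT, Finset.mem_insert, Finset.mem_singleton, not_or] at hpT
      simp only [c, if_neg hpT.1, if_neg hpT.2.1, if_neg hpT.2.2.1, if_neg hpT.2.2.2.1,
        if_neg hpT.2.2.2.2.1, if_neg hpT.2.2.2.2.2]
    rw [← hsplit, hone, one_mul]
    calc ∏ p ∈ n.primeFactors ∩ T, c p ≤ ∏ p ∈ T, c p :=
          Finset.prod_le_prod_of_subset_of_one_le Finset.inter_subset_right (fun p _ ↦ hc0 p)
            fun p _ _ ↦ hc1 p
      _ ≤ 5092 := by
        rw [hT, Finset.prod_insert (by decide), Finset.prod_insert (by decide),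
          Finset.prod_insert (by decide), Finset.prod_insert (by decide),
          Finset.prod_insert (by decide), Finset.prod_singleton]
        simp only [c]
        norm_num
  rcases eq_or_ne n 0 with rfl | hn
  · simp
  · calc ((n.divisors.card : ℕ) : ℝ) ^ 4 ≤ (∏ p ∈ n.primeFactors, c p) * n := key n hn
      _ ≤ 5092 * n := mul_le_mul_of_nonneg_right (hprod n) (Nat.cast_nonneg n)

/-- Every summand of `β`: **`log(τ(j) j^{1/2}) ≤ ¼ log 5092 + ¾ log l` for `1 ≤ j ≤ l`**
(`(τ(j)√j)⁴ = τ(j)⁴ j² ≤ 5092 j³ ≤ 5092 l³`; the print: "`τ(j) j^{1/2} ≤ 8.5 j^{3/4}`").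
[cite: VonkanelMatschke2023, §10.5.3 (eq:tau) and the display `β ≤ β'`] -/
theorem log_card_divisors_mul_sqrt_le {j l : ℕ} (hj : 1 ≤ j) (hjl : j ≤ l) :
    Real.log ((j.divisors.card : ℝ) * Real.sqrt j) ≤ Real.log 5092 / 4 + 3 / 4 * Real.log l := by
  have hτ := card_divisors_pow_four_le j
  have hj' : (1 : ℝ) ≤ j := by exact_mod_cast hj
  have hl' : (j : ℝ) ≤ l := by exact_mod_cast hjl
  have hl1 : (1 : ℝ) ≤ l := hj'.trans hl'
  have hτ1 : (1 : ℝ) ≤ (j.divisors.card : ℝ) := by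
    exact_mod_cast Finset.card_pos.mpr ⟨1, Nat.one_mem_divisors.mpr (by omega)⟩
  have hx : 0 < (j.divisors.card : ℝ) * Real.sqrt j := by positivity
  have h4 : ((j.divisors.card : ℝ) * Real.sqrt j) ^ 4 = (j.divisors.card : ℝ) ^ 4 * (j : ℝ) ^ 2 := by
    rw [mul_pow, show (4 : ℕ) = 2 * 2 from rfl, pow_mul (Real.sqrt j), Real.sq_sqrt (by positivity)]
  have hle : ((j.divisors.card : ℝ) * Real.sqrt j) ^ 4 ≤ 5092 * (l : ℝ) ^ 3 := by
    rw [h4]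
    have hτ' : (j.divisors.card : ℝ) ^ 4 ≤ 5092 * j := by exact_mod_cast hτ
    calc (j.divisors.card : ℝ) ^ 4 * (j : ℝ) ^ 2 ≤ (5092 * j) * (j : ℝ) ^ 2 := by gcongr
      _ = 5092 * (j : ℝ) ^ 3 := by ring
      _ ≤ 5092 * (l : ℝ) ^ 3 := by gcongr
  have hlog := Real.log_le_log (by positivity) hle
  rw [Real.log_pow, Real.log_mul (x := (5092 : ℝ)) (y := (l : ℝ) ^ 3) (by norm_num) (by positivity),
    Real.log_pow] at hlog
  push_cast at hlog
  linarith

/-! ### 2. `max_J Σ_{j∈J} log(τ(j)√j) ≤ m (¼ log 5092 + ¾ log l)` -/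

/-- **`max_{J ⊆ {1,…,l}, |J| ≤ m} Σ_{j∈J} log(τ(j) j^{1/2}) ≤ m (¼ log 5092 + ¾ log l)`** (`l ≥ 1`):
each summand is `≤ ¼ log 5092 + ¾ log l ≥ 0` and there are at most `m` of them — the step
"(eq:tau) gives `β ≤ β' = m(½ log m + ¾ log l + log 8.5)`" of the printed proof, with `8.5`
replaced by `5092^{1/4} = 8.447…`. [cite: VonkanelMatschke2023, §10.5.3 (display `β ≤ β'`)] -/
theorem maxLogTauSum_le {l : ℕ} (hl : 1 ≤ l) (m : ℕ) :
    maxLogTauSum l m ≤ m * (Real.log 5092 / 4 + 3 / 4 * Real.log l) := by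
  unfold maxLogTauSum
  refine Finset.sup'_le _ _ fun J hJ ↦ ?_
  obtain ⟨hJsub, hJcard⟩ := Finset.mem_filter.mp hJ
  rw [Finset.mem_powerset] at hJsub
  have hT : 0 ≤ Real.log 5092 / 4 + 3 / 4 * Real.log l := by
    have h1 : 0 ≤ Real.log 5092 := Real.log_nonneg (by norm_num)
    have h2 : 0 ≤ Real.log l := Real.log_nonneg (by exact_mod_cast hl)
    positivity
  calc ∑ j ∈ J, Real.log ((j.divisors.card : ℝ) * Real.sqrt j)
      ≤ ∑ _j ∈ J, (Real.log 5092 / 4 + 3 / 4 * Real.log l) := Finset.sum_le_sum fun j hj ↦ by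
        have h := Finset.mem_Icc.mp (hJsub hj)
        exact log_card_divisors_mul_sqrt_le h.1 h.2
    _ = J.card * (Real.log 5092 / 4 + 3 / 4 * Real.log l) := by rw [Finset.sum_const, nsmul_eq_mul]
    _ ≤ m * (Real.log 5092 / 4 + 3 / 4 * Real.log l) :=
        mul_le_mul_of_nonneg_right (by exact_mod_cast hJcard) hT

/-- `maxLogTauSum l m ≥ 0` (the empty set `J` is admissible). [cite: VonkanelMatschke2023, §10.5.1 (def:bb*)] -/
theorem maxLogTauSum_nonneg (l m : ℕ) : 0 ≤ maxLogTauSum l m := by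
  unfold maxLogTauSum
  exact Finset.le_sup'_of_le _ (b := ∅) (by simp) (by simp)

/-! ### 3. The index `l = ⌊(N/6)∏_{p∣N}(p+1)⌋` -/

/-- `l ≤ (N/6) ∏_{p ∣ N}(p + 1)` over `ℝ` (the floor dropped). [cite: VonkanelMatschke2023, §10.5.1 (def:bb*)] -/
theorem vkmIndexL_le_mul_prod (N : ℕ) :
    (vkmIndexL N : ℝ) ≤ (N : ℝ) * (∏ p ∈ N.primeFactors, ((p : ℝ) + 1)) / 6 := by
  unfold vkmIndexL
  have h := Nat.cast_div_le (m := N * ∏ p ∈ N.primeFactors, (p + 1)) (n := 6) (α := ℝ)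
  push_cast at h
  exact h

/-- `l ≥ 1` for `N ≥ 2` (`N ∏_{p∣N}(p+1) ≥ 2 · 3`). [cite: VonkanelMatschke2023, §10.5.1 (def:bb*)] -/
theorem one_le_vkmIndexL {N : ℕ} (hN : 2 ≤ N) : 1 ≤ vkmIndexL N := by
  unfold vkmIndexL
  obtain ⟨q, hq⟩ : N.primeFactors.Nonempty := Nat.nonempty_primeFactors.mpr (by omega)
  have hq2 : 2 ≤ q := (Nat.prime_of_mem_primeFactors hq).two_le
  have h3 : 3 ≤ ∏ p ∈ N.primeFactors, (p + 1) := by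
    rw [← Finset.mul_prod_erase _ _ hq]
    have hne : ∏ p ∈ N.primeFactors.erase q, (p + 1) ≠ 0 :=
      Finset.prod_ne_zero_iff.mpr fun p _ ↦ Nat.succ_ne_zero p
    have h1 : 1 ≤ ∏ p ∈ N.primeFactors.erase q, (p + 1) := Nat.one_le_iff_ne_zero.mpr hne
    nlinarith
  rw [Nat.le_div_iff_mul_le (by norm_num)]
  nlinarith

/-- The product of distinct primes is squarefree. [folklore] -/
private theorem squarefree_prod_primes (s : Finset ℕ) (hs : ∀ p ∈ s, p.Prime) :
    Squarefree (∏ p ∈ s, p) := by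
  classical
  induction s using Finset.induction_on with
  | empty => simp
  | insert q s hq ih =>
    rw [Finset.prod_insert hq, Nat.squarefree_mul_iff]
    have hqp : q.Prime := hs q (Finset.mem_insert_self q s)
    have hs' : ∀ p ∈ s, p.Prime := fun p hp ↦ hs p (Finset.mem_insert_of_mem hp)
    refine ⟨Nat.Coprime.prod_right fun p hp ↦ (Nat.coprime_primes hqp (hs' p hp)).mpr ?_,
      hqp.prime.squarefree, ih hs'⟩
    rintro rfl; exact hq hp

/-- `σ(rad N) = ∏_{p ∣ N}(p + 1)` and **Robin's inequality for the radical** (CLMS 2007, Thm. 1.1,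
PROVED in the tree): if `rad N = ∏_{p∣N} p ∉ {2, 3, 5, 6, 10, 30}` and `N ≥ 2`, then
`∏_{p ∣ N}(p + 1) < e^γ · rad(N) · log log rad(N) ≤ e^γ N log log N`. This replaces the printed
(eq:keyexplbound) `∏_{p∣n}(1+1/p) ≤ (6e^γ/π²)(log log n + 2/log log n)` (weaker by `π²/6`).
[cite: CLMS2007, Thm 1.1] -/
theorem prod_primeFactors_add_one_lt {N : ℕ} (hN : 2 ≤ N)
    (hrad : ∏ p ∈ N.primeFactors, p ∉ ({2, 3, 5, 6, 10, 30} : Finset ℕ)) :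
    (∏ p ∈ N.primeFactors, ((p : ℝ) + 1)) <
      Real.exp Real.eulerMascheroniConstant * N * Real.log (Real.log N) := by
  set R : ℕ := ∏ p ∈ N.primeFactors, p with hR
  have hprime : ∀ p ∈ N.primeFactors, p.Prime := fun p hp ↦ Nat.prime_of_mem_primeFactors hp
  obtain ⟨q, hq⟩ : N.primeFactors.Nonempty := Nat.nonempty_primeFactors.mpr (by omega)
  have hRsq : Squarefree R := squarefree_prod_primes _ hprime
  have hqR : q ∣ R := Finset.dvd_prod_of_mem _ hq
  have hR2 : 2 ≤ R := le_trans (hprime q hq).two_le (Nat.le_of_dvd hRsq.ne_zero.bot_lt hqR)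
  have hRN : R ≤ N := Nat.le_of_dvd (by omega) (Nat.prod_primeFactors_dvd N)
  have hrobin := Literature.NumberTheory.LFunctions.robinInequality_of_squarefree hRsq (by omega) hrad
  unfold Literature.NumberTheory.LFunctions.robinInequality at hrobin
  rw [Literature.NumberTheory.LFunctions.CLMS2007.sigma_prod_primes _ hprime, Nat.cast_prod] at hrobin
  push_cast at hrobin
  -- `R ≤ N` and `log log R ≤ log log N`
  have hR2' : (2 : ℝ) ≤ R := by exact_mod_cast hR2
  have hRN' : (R : ℝ) ≤ N := by exact_mod_cast hRN
  have hlogR : 0 < Real.log R := Real.log_pos (by linarith)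
  have hll : Real.log (Real.log R) ≤ Real.log (Real.log N) :=
    Real.log_le_log hlogR (Real.log_le_log (by linarith) hRN')
  -- CLMS gives a strict inequality with a positive right-hand side, so `log log R > 0` is not needed:
  have hpos : 0 < ∏ p ∈ N.primeFactors, ((p : ℝ) + 1) := Finset.prod_pos fun p _ ↦ by positivity
  have hγ : 0 < Real.exp Real.eulerMascheroniConstant := Real.exp_pos _
  have hllR : 0 < Real.log (Real.log R) := by
    by_contra h
    rw [not_lt] at h
    have : Real.exp Real.eulerMascheroniConstant * R * Real.log (Real.log R) ≤ 0 :=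
      mul_nonpos_of_nonneg_of_nonpos (by positivity) h
    linarith
  calc (∏ p ∈ N.primeFactors, ((p : ℝ) + 1))
      < Real.exp Real.eulerMascheroniConstant * R * Real.log (Real.log R) := hrobin
    _ ≤ Real.exp Real.eulerMascheroniConstant * N * Real.log (Real.log N) := by
        gcongr

/-- **(eq:lbound)-substitute, generic radical: `l ≤ (e^γ/6) N² log log N`** for `N ≥ 2` with
`rad N ∉ {2, 3, 5, 6, 10, 30}` (print: `l ≤ (e^γ/π²) N² (log log N + 2/log log N)`).
[cite: VonkanelMatschke2023, §10.5.3 (eq:lbound)] -/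
theorem vkmIndexL_le_of_rad_not_mem {N : ℕ} (hN : 2 ≤ N)
    (hrad : ∏ p ∈ N.primeFactors, p ∉ ({2, 3, 5, 6, 10, 30} : Finset ℕ)) :
    (vkmIndexL N : ℝ) ≤
      Real.exp Real.eulerMascheroniConstant / 6 * (N : ℝ) ^ 2 * Real.log (Real.log N) := by
  have h1 := vkmIndexL_le_mul_prod N
  have h2 := prod_primeFactors_add_one_lt hN hrad
  have hN0 : (0 : ℝ) ≤ N := Nat.cast_nonneg N
  calc (vkmIndexL N : ℝ) ≤ (N : ℝ) * (∏ p ∈ N.primeFactors, ((p : ℝ) + 1)) / 6 := h1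
    _ ≤ (N : ℝ) * (Real.exp Real.eulerMascheroniConstant * N * Real.log (Real.log N)) / 6 :=
        div_le_div_of_nonneg_right (mul_le_mul_of_nonneg_left h2.le hN0) (by norm_num)
    _ = _ := by ring

/-- In the six exceptional radical classes every prime factor is `2, 3` or `5`, so
`∏_{p ∣ N}(1 + 1/p) ≤ (3/2)(4/3)(6/5) = 12/5` and `∏_{p∣N}(p+1) ≤ (12/5) N`. [cite: CLMS2007, Thm 1.1 (the set 𝓑)] -/
theorem prod_primeFactors_add_one_le_of_rad_mem {N : ℕ} (hN : N ≠ 0)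
    (hrad : ∏ p ∈ N.primeFactors, p ∈ ({2, 3, 5, 6, 10, 30} : Finset ℕ)) :
    (∏ p ∈ N.primeFactors, ((p : ℝ) + 1)) ≤ 12 / 5 * N := by
  set R : ℕ := ∏ p ∈ N.primeFactors, p with hR
  have hR30 : R ∣ 30 := by
    simp only [Finset.mem_insert, Finset.mem_singleton] at hrad
    rcases hrad with h | h | h | h | h | h <;> rw [h] <;> norm_num
  have hsub : N.primeFactors ⊆ ({2, 3, 5} : Finset ℕ) := by
    intro p hp
    have hpp := Nat.prime_of_mem_primeFactors hp
    have hp30 : p ∣ 2 * 3 * 5 := (Finset.dvd_prod_of_mem _ hp).trans hR30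
    simp only [Finset.mem_insert, Finset.mem_singleton]
    rcases (Nat.Prime.dvd_mul hpp).mp hp30 with h | h
    · rcases (Nat.Prime.dvd_mul hpp).mp h with h | h
      · exact Or.inl ((Nat.prime_dvd_prime_iff_eq hpp Nat.prime_two).mp h)
      · exact Or.inr (Or.inl ((Nat.prime_dvd_prime_iff_eq hpp Nat.prime_three).mp h))
    · exact Or.inr (Or.inr ((Nat.prime_dvd_prime_iff_eq hpp Nat.prime_five).mp h))
  -- `∏ (p+1) = ∏ p · ∏ (1 + 1/p) ≤ rad(N) · 12/5 ≤ (12/5) N`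
  have hsplit : (∏ p ∈ N.primeFactors, ((p : ℝ) + 1)) =
      (∏ p ∈ N.primeFactors, (p : ℝ)) * ∏ p ∈ N.primeFactors, (1 + 1 / (p : ℝ)) := by
    rw [← Finset.prod_mul_distrib]
    refine Finset.prod_congr rfl fun p hp ↦ ?_
    have hp0 : (p : ℝ) ≠ 0 := by exact_mod_cast (Nat.prime_of_mem_primeFactors hp).ne_zero
    field_simp
  have hfrac : ∏ p ∈ N.primeFactors, (1 + 1 / (p : ℝ)) ≤ 12 / 5 := by
    calc ∏ p ∈ N.primeFactors, (1 + 1 / (p : ℝ)) ≤ ∏ p ∈ ({2, 3, 5} : Finset ℕ), (1 + 1 / (p : ℝ)) :=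
          Finset.prod_le_prod_of_subset_of_one_le hsub (fun p _ ↦ by positivity) fun p _ _ ↦ by
            have : 0 ≤ 1 / (p : ℝ) := by positivity
            linarith
      _ = 12 / 5 := by
          rw [Finset.prod_insert (by decide), Finset.prod_insert (by decide), Finset.prod_singleton]
          norm_num
  have hradN : (∏ p ∈ N.primeFactors, (p : ℝ)) ≤ N := by
    have h := Nat.le_of_dvd (Nat.pos_of_ne_zero hN) (Nat.prod_primeFactors_dvd N)
    have h' : ((∏ p ∈ N.primeFactors, p : ℕ) : ℝ) ≤ N := by exact_mod_cast h
    rwa [Nat.cast_prod] at h'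
  have hrad0 : 0 ≤ ∏ p ∈ N.primeFactors, (p : ℝ) := Finset.prod_nonneg fun p _ ↦ Nat.cast_nonneg p
  rw [hsplit]
  calc (∏ p ∈ N.primeFactors, (p : ℝ)) * ∏ p ∈ N.primeFactors, (1 + 1 / (p : ℝ))
      ≤ (N : ℝ) * (12 / 5) :=
        mul_le_mul hradN hfrac (Finset.prod_nonneg fun p _ ↦ by positivity) (Nat.cast_nonneg N)
    _ = 12 / 5 * N := by ring

/-- **(eq:lbound)-substitute, exceptional radical: `l ≤ (2/5) N²`** when
`rad N ∈ {2, 3, 5, 6, 10, 30}` (`N ≥ 1`). [cite: VonkanelMatschke2023, §10.5.3 (eq:lbound)] -/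
theorem vkmIndexL_le_of_rad_mem {N : ℕ} (hN : N ≠ 0)
    (hrad : ∏ p ∈ N.primeFactors, p ∈ ({2, 3, 5, 6, 10, 30} : Finset ℕ)) :
    (vkmIndexL N : ℝ) ≤ 2 / 5 * (N : ℝ) ^ 2 := by
  have h1 := vkmIndexL_le_mul_prod N
  have h2 := prod_primeFactors_add_one_le_of_rad_mem hN hrad
  have hN0 : (0 : ℝ) ≤ N := Nat.cast_nonneg N
  calc (vkmIndexL N : ℝ) ≤ (N : ℝ) * (∏ p ∈ N.primeFactors, ((p : ℝ) + 1)) / 6 := h1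
    _ ≤ (N : ℝ) * (12 / 5 * N) / 6 :=
        div_le_div_of_nonneg_right (mul_le_mul_of_nonneg_left h2 hN0) (by norm_num)
    _ = 2 / 5 * (N : ℝ) ^ 2 := by ring

end Literature.NumberTheory.EllipticCurves.ModularForms

end
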